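import Summits.AtomisticToContinuum.Crystallization.Theorems.FrustratedLawDichotomySignedLedger

/-!
# FrustratedLawDichotomy · crux `AperiodicFrustratedLawGap` (stmt-AtomisticToContinuum-27623) — T3: LEDGERS FROM POINTWISE FLOORS
# (decomp-a2c, RESIDUAL lens-5 «finite/base range + asymptotic regime + bridge», generation 112; reading A′: E′ ⟸ hdef alone, TREE #62)

`hdef` asks, for every admissible minimising law `P`, for a `LawLedger P e⋆` (tree `…SignedLedger`).  The class-A atlas (T2 `…CoherentFloor`:
`certFloor ≤ 2·rootEnergy` per cell) and the class-H / class-B instruments deliver POINTWISE almost-sure floors `e⋆ + m_i ≤ rootEnergy μ` on measurable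
ROW CLASSES `K_i` with booked margins `m_i` of either sign; on the uncovered roots (the residual core: class D, the interfaces D∂, anything uncertified)
nothing is known.  This file is the bookkeeping that turns such data into a ledger, with ZERO transport:

* `lawLedgerOfMargin` ★ — an integrable MARGIN FUNCTION `m` with `e⋆ + m μ ≤ rootEnergy μ` a.s. and `0 < E_P[m]` is a ledger at level `e⋆`
  (good = everything, `γ = E_P[m]`, charge `q = E_P[m] − m`, `F = G = 0`);
* `rowCell K i = K i ∖ ⋃_{j<i} K j` (first-hit disjointification of the rows), `marginOfRows` (= `m_i` on `rowCell K i`, `rootEnergy − e⋆` off the rows);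
* `lawLedgerOfRows` ★★ — rows `K_i` (`i < n`, measurable, possibly overlapping), margins `m_i : ℝ` (any sign), a.s. floors on each row, and ONE residual
  inequality «mean deficit of the uncovered roots < booked credit of the rows»
  `∫_{(⋃_{i<n} K_i)ᶜ} (e⋆ − rootEnergy μ) dP < Σ_{i<n} m_i · P(rowCell K i)` ⟹ `LawLedger P e⋆`;
  `lt_integral_rootEnergy_of_rows` — hence `e⋆ < E_P[rootEnergy]` for point-stationary hard-core `P` (by `LawLedger.lt_integral_rootEnergy`).

T4 (next) instantiates the rows with the atlas cells (A: `m = ½·certFloor − e⋆ − …` per cell, H: `−tax`, B: `+σ`) and names the residual inequality over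
the D-core as ONE hypothesis (critic r1747 (C)); the route door is the tree's `…SignedLedger.aperiodicFrustratedLawGap_of_lawLedger`.
DEFS `lawLedgerOfMargin rowCell marginOfRows lawLedgerOfRows` (plain `def`s; no instance / notation); imports TREE `…SignedLedger` only; 0 sorry.
Tags: [new: bookkeeping only].
-/

noncomputable section

namespace Summit.AtomisticToContinuum.Crystallization.Theorems.FrustratedLawDichotomyMarginLedger

open MeasureTheory Set Filter
open scoped ENNReal BigOperators
open Literature.MathematicalPhysics.StatisticalMechanics Literature.Probability.Process
open Summit.AtomisticToContinuum.Crystallization.Theorems.ChargedEnergyGapNegative (E3)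
open Summit.AtomisticToContinuum.Crystallization.Theorems.FrustratedLawDichotomySignedLedger (LawLedger net)
open Summit.AtomisticToContinuum.Crystallization.Theorems.FrustratedLawDichotomyFiniteClusterGap (integrable_rootEnergy_of_ae_hardCore)

variable {δ : ℝ} {P : Measure (Measure E3)}

/-! ## §1. A margin function with positive mean is a zero-transport ledger -/

/-- With zero transport the net signed flow vanishes. [new: bookkeeping] -/
theorem net_zero (μ : Measure E3) : net (fun _ _ => 0) (fun _ _ => 0) μ = 0 := by
  simp [net]

/-- ★ **LEDGER FROM A MARGIN FUNCTION.**  An integrable `m` with `c + m μ ≤ rootEnergy V_LJ μ` almost surely and `0 < E_P[m]` gives a ledger at level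
`c`: every root good, credit `γ = E_P[m]`, charge `q = E_P[m] − m` (mean zero… strictly, `E_P[q] = 0 < γ`), no transport. [new: bookkeeping] -/
def lawLedgerOfMargin [IsProbabilityMeasure P] {c : ℝ} (m : Measure E3 → ℝ) (hm : Integrable m P)
    (hfloor : ∀ᵐ μ ∂P, c + m μ ≤ rootEnergy lennardJones μ) (hpos : 0 < ∫ μ, m μ ∂P) : LawLedger P c where
  F := fun _ _ => 0
  G := fun _ _ => 0
  measF := measurable_const
  measG := measurable_const
  outF_ne_top := by simp
  outG_ne_top := by simp
  good := Set.univ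
  good_meas := MeasurableSet.univ
  γ := ∫ μ, m μ ∂P
  σ := 0
  q := fun μ => (∫ μ, m μ ∂P) - m μ
  r := fun _ => 0
  q_int := (integrable_const _).sub hm
  r_int := integrable_const 0
  floor_good := by
    filter_upwards [hfloor] with μ hμ _
    rw [net_zero]
    linarith
  floor_bad := ae_of_all _ fun μ hμ => absurd (Set.mem_univ μ) hμ
  coercive := by
    have h1 : ∫ μ in Set.univ, ((∫ μ, m μ ∂P) - m μ) ∂P = (∫ μ, m μ ∂P) - ∫ μ, m μ ∂P := by
      rw [Measure.restrict_univ, integral_sub (integrable_const _) hm, integral_const, smul_eq_mul, probReal_univ, one_mul]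
    rw [h1, integral_zero, probReal_univ]
    linarith

/-- Corollary: a margin function with positive mean prices the mean root energy strictly above `c`. [new: bookkeeping] -/
theorem lt_integral_rootEnergy_of_margin [IsProbabilityMeasure P] {c : ℝ} (hδ : 0 < δ) (hcore : ∀ᵐ μ ∂P, IsRootedHardCore δ μ)
    (hstat : IsPointStationaryLaw P) (m : Measure E3 → ℝ) (hm : Integrable m P)
    (hfloor : ∀ᵐ μ ∂P, c + m μ ≤ rootEnergy lennardJones μ) (hpos : 0 < ∫ μ, m μ ∂P) : c < ∫ μ, rootEnergy lennardJones μ ∂P :=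
  (lawLedgerOfMargin m hm hfloor hpos).lt_integral_rootEnergy hδ hcore hstat

/-! ## §2. Finite row atlases: first-hit cells, the margin of a row atlas, and the ledger -/

/-- The FIRST-HIT CELL of row `i`: the roots in `K i` and in no earlier row (the rows may overlap; the cells do not). [new: bookkeeping] -/
def rowCell (K : ℕ → Set (Measure E3)) (i : ℕ) : Set (Measure E3) := K i \ ⋃ j ∈ Finset.range i, K j

/-- A first-hit cell lies in its row. [new: bookkeeping] -/
theorem rowCell_subset (K : ℕ → Set (Measure E3)) (i : ℕ) : rowCell K i ⊆ K i := sdiff_subset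

/-- First-hit cells of measurable rows are measurable. [new: bookkeeping] -/
theorem measurableSet_rowCell {K : ℕ → Set (Measure E3)} (hK : ∀ i, MeasurableSet (K i)) (i : ℕ) : MeasurableSet (rowCell K i) :=
  (hK i).diff (Finset.measurableSet_biUnion _ fun j _ => hK j)

/-- First-hit cells are pairwise disjoint. [new: bookkeeping] -/
theorem eq_of_mem_rowCell {K : ℕ → Set (Measure E3)} {μ : Measure E3} {i i' : ℕ} (hi : μ ∈ rowCell K i) (hi' : μ ∈ rowCell K i') : i = i' := by
  by_contra hne
  rcases lt_or_gt_of_ne hne with h | h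
  · exact hi'.2 (Set.mem_biUnion (Finset.mem_range.2 h) hi.1)
  · exact hi.2 (Set.mem_biUnion (Finset.mem_range.2 h) hi'.1)

/-- A covered root lies in the first-hit cell of its least row. [new: bookkeeping] -/
theorem exists_mem_rowCell {K : ℕ → Set (Measure E3)} {μ : Measure E3} {n : ℕ} (h : μ ∈ ⋃ i ∈ Finset.range n, K i) :
    ∃ i ∈ Finset.range n, μ ∈ rowCell K i := by
  classical
  obtain ⟨i, hi, hμ⟩ := Set.mem_iUnion₂.1 h
  have hex : ∃ j, μ ∈ K j := ⟨i, hμ⟩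
  refine ⟨Nat.find hex, Finset.mem_range.2 (lt_of_le_of_lt (Nat.find_min' hex hμ) (Finset.mem_range.1 hi)), Nat.find_spec hex, ?_⟩
  intro hmem
  obtain ⟨j, hj, hμj⟩ := Set.mem_iUnion₂.1 hmem
  exact Nat.find_min hex (Finset.mem_range.1 hj) hμj

/-- THE MARGIN OF A ROW ATLAS: the booked margin `m_i` on the first-hit cell of row `i < n`, the tautological `rootEnergy − c` off the rows.
[new: bookkeeping] -/
def marginOfRows (c : ℝ) (n : ℕ) (K : ℕ → Set (Measure E3)) (mK : ℕ → ℝ) (μ : Measure E3) : ℝ :=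
  ∑ i ∈ Finset.range n, (rowCell K i).indicator (fun _ => mK i) μ + (⋃ i ∈ Finset.range n, K i)ᶜ.indicator (fun μ => rootEnergy lennardJones μ - c) μ

/-- On the first-hit cell of row `i < n` the atlas margin is `m_i`. [new: bookkeeping] -/
theorem marginOfRows_of_mem {c : ℝ} {n : ℕ} {K : ℕ → Set (Measure E3)} {mK : ℕ → ℝ} {μ : Measure E3} {i : ℕ} (hi : i ∈ Finset.range n)
    (hμ : μ ∈ rowCell K i) : marginOfRows c n K mK μ = mK i := by
  unfold marginOfRows
  have hcov : μ ∈ ⋃ j ∈ Finset.range n, K j := Set.mem_biUnion hi (rowCell_subset K i hμ)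
  rw [Set.indicator_of_notMem (Set.notMem_compl_iff.2 hcov), add_zero, Finset.sum_eq_single_of_mem i hi fun j _ hji => ?_]
  · exact Set.indicator_of_mem hμ _
  · exact Set.indicator_of_notMem (fun hμj => hji (eq_of_mem_rowCell hμj hμ)) _

/-- Off the rows the atlas margin is the tautological one. [new: bookkeeping] -/
theorem marginOfRows_of_not_mem {c : ℝ} {n : ℕ} {K : ℕ → Set (Measure E3)} {mK : ℕ → ℝ} {μ : Measure E3} (hμ : μ ∉ ⋃ i ∈ Finset.range n, K i) :
    marginOfRows c n K mK μ = rootEnergy lennardJones μ - c := by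
  unfold marginOfRows
  rw [Set.indicator_of_mem (Set.mem_compl hμ), Finset.sum_eq_zero fun i hi => ?_, zero_add]
  exact Set.indicator_of_notMem (fun h => hμ (Set.mem_biUnion hi (rowCell_subset K i h))) _

/-- The atlas margin is a pointwise floor almost surely, given the row floors. [new: bookkeeping] -/
theorem floor_marginOfRows {c : ℝ} {n : ℕ} {K : ℕ → Set (Measure E3)} {mK : ℕ → ℝ}
    (hfloor : ∀ i < n, ∀ᵐ μ ∂P, μ ∈ K i → c + mK i ≤ rootEnergy lennardJones μ) :
    ∀ᵐ μ ∂P, c + marginOfRows c n K mK μ ≤ rootEnergy lennardJones μ := by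
  have hall : ∀ᵐ μ ∂P, ∀ i, i < n → μ ∈ K i → c + mK i ≤ rootEnergy lennardJones μ := by
    refine ae_all_iff.2 fun i => ?_
    by_cases hi : i < n
    · filter_upwards [hfloor i hi] with μ h using fun _ => h
    · exact ae_of_all _ fun μ hi' => absurd hi' hi
  filter_upwards [hall] with μ hμ
  by_cases hcov : μ ∈ ⋃ i ∈ Finset.range n, K i
  · obtain ⟨i, hi, hμi⟩ := exists_mem_rowCell hcov
    rw [marginOfRows_of_mem hi hμi]
    exact hμ i (Finset.mem_range.1 hi) (rowCell_subset K i hμi)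
  · rw [marginOfRows_of_not_mem hcov]
    linarith

/-- The atlas margin is integrable (hard core ⇒ `rootEnergy` integrable). [new: bookkeeping] -/
theorem integrable_marginOfRows [IsProbabilityMeasure P] {c : ℝ} {n : ℕ} {K : ℕ → Set (Measure E3)} (hK : ∀ i, MeasurableSet (K i)) {mK : ℕ → ℝ}
    (hδ : 0 < δ) (hcore : ∀ᵐ μ ∂P, IsRootedHardCore δ μ) : Integrable (marginOfRows c n K mK) P := by
  refine (integrable_finsetSum _ fun i _ => (integrable_const (mK i)).indicator (measurableSet_rowCell hK i)).add ?_
  exact ((integrable_rootEnergy_of_ae_hardCore hδ hcore).sub (integrable_const c)).indicator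
    (Finset.measurableSet_biUnion _ fun j _ => hK j).compl

/-- ★ THE MEAN OF THE ATLAS MARGIN = booked credit of the first-hit cells − mean deficit of the uncovered roots. [new: bookkeeping] -/
theorem integral_marginOfRows [IsProbabilityMeasure P] {c : ℝ} {n : ℕ} {K : ℕ → Set (Measure E3)} (hK : ∀ i, MeasurableSet (K i)) {mK : ℕ → ℝ}
    (hδ : 0 < δ) (hcore : ∀ᵐ μ ∂P, IsRootedHardCore δ μ) :
    ∫ μ, marginOfRows c n K mK μ ∂P =
      ∑ i ∈ Finset.range n, mK i * P.real (rowCell K i) - ∫ μ in (⋃ i ∈ Finset.range n, K i)ᶜ, (c - rootEnergy lennardJones μ) ∂P := by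
  have hU : MeasurableSet (⋃ i ∈ Finset.range n, K i) := Finset.measurableSet_biUnion _ fun j _ => hK j
  have hI1 : Integrable (fun μ => ∑ i ∈ Finset.range n, (rowCell K i).indicator (fun _ => mK i) μ) P :=
    integrable_finsetSum _ fun i _ => (integrable_const (mK i)).indicator (measurableSet_rowCell hK i)
  have hIe := integrable_rootEnergy_of_ae_hardCore hδ hcore
  have hI2 : Integrable ((⋃ i ∈ Finset.range n, K i)ᶜ.indicator fun μ => rootEnergy lennardJones μ - c) P :=
    (hIe.sub (integrable_const c)).indicator hU.compl
  unfold marginOfRows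
  rw [integral_add hI1 hI2, integral_finsetSum _ fun i _ => (integrable_const (mK i)).indicator (measurableSet_rowCell hK i),
    integral_indicator hU.compl]
  have h1 : ∀ i ∈ Finset.range n, ∫ μ, (rowCell K i).indicator (fun _ => mK i) μ ∂P = mK i * P.real (rowCell K i) := fun i _ => by
    rw [integral_indicator_const _ (measurableSet_rowCell hK i), smul_eq_mul, mul_comm]
  have h2 : ∫ μ in (⋃ i ∈ Finset.range n, K i)ᶜ, (rootEnergy lennardJones μ - c) ∂P =
      -∫ μ in (⋃ i ∈ Finset.range n, K i)ᶜ, (c - rootEnergy lennardJones μ) ∂P := by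
    rw [← integral_neg]
    exact integral_congr_ae (ae_of_all _ fun μ => by ring)
  rw [Finset.sum_congr rfl h1, h2]
  ring

/-- ★★ **LEDGER FROM A FINITE ROW ATLAS + ONE RESIDUAL INEQUALITY.**  Rows `K i` (`i < n`, measurable, possibly overlapping) with booked margins `m_i`
(any sign: `+γ_cell` for class A, `−tax` for halo rows, `+σ` for class B) and almost-sure floors `c + m_i ≤ rootEnergy V_LJ μ` on `K i`; if the MEAN DEFICIT
of the uncovered roots is below the booked credit of the first-hit cells,
`∫_{(⋃_{i<n} K i)ᶜ} (c − rootEnergy μ) dP < Σ_{i<n} m_i·P(rowCell K i)`, then there is a (zero-transport) ledger at level `c`. [new: bookkeeping] -/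
def lawLedgerOfRows [IsProbabilityMeasure P] {c : ℝ} (hδ : 0 < δ) (hcore : ∀ᵐ μ ∂P, IsRootedHardCore δ μ) (n : ℕ)
    (K : ℕ → Set (Measure E3)) (hK : ∀ i, MeasurableSet (K i)) (mK : ℕ → ℝ)
    (hfloor : ∀ i < n, ∀ᵐ μ ∂P, μ ∈ K i → c + mK i ≤ rootEnergy lennardJones μ)
    (hres : ∫ μ in (⋃ i ∈ Finset.range n, K i)ᶜ, (c - rootEnergy lennardJones μ) ∂P < ∑ i ∈ Finset.range n, mK i * P.real (rowCell K i)) :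
    LawLedger P c :=
  lawLedgerOfMargin (marginOfRows c n K mK) (integrable_marginOfRows hK hδ hcore) (floor_marginOfRows hfloor)
    (by rw [integral_marginOfRows hK hδ hcore]; linarith)

/-- Corollary: a finite row atlas with the residual inequality prices the mean root energy of a point-stationary hard-core law strictly above `c`.
[new: bookkeeping] -/
theorem lt_integral_rootEnergy_of_rows [IsProbabilityMeasure P] {c : ℝ} (hδ : 0 < δ) (hcore : ∀ᵐ μ ∂P, IsRootedHardCore δ μ)
    (hstat : IsPointStationaryLaw P) (n : ℕ) (K : ℕ → Set (Measure E3)) (hK : ∀ i, MeasurableSet (K i)) (mK : ℕ → ℝ)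
    (hfloor : ∀ i < n, ∀ᵐ μ ∂P, μ ∈ K i → c + mK i ≤ rootEnergy lennardJones μ)
    (hres : ∫ μ in (⋃ i ∈ Finset.range n, K i)ᶜ, (c - rootEnergy lennardJones μ) ∂P < ∑ i ∈ Finset.range n, mK i * P.real (rowCell K i)) :
    c < ∫ μ, rootEnergy lennardJones μ ∂P :=
  (lawLedgerOfRows hδ hcore n K hK mK hfloor hres).lt_integral_rootEnergy hδ hcore hstat

end Summit.AtomisticToContinuum.Crystallization.Theorems.FrustratedLawDichotomyMarginLedger

end
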